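import Summits.CriticalPhenomena.CardyFormulaZ2.Theorems.CardyIKTransportIKMixedBoxCrossingDefectDefs

-- the stub lives in the skeleton's namespace `…Cruxes.IKMixedBoxCrossing.DefectClosureExploration`, not the file path's
set_option linter.dupNamespace false

/-!
# Stub `stub_gadget` of the line `defect-closure-exploration` (crux `IKMixedBoxCrossing`,
stmt-CriticalPhenomena-5911): the gadget / mask representation `GadgetRepresentation`

For `t ≤ 1`, every finite volume `Λ`, every interaction set `V ⊆ innerVertices Λ` and every boundary condition
`ξ`, the corner Gibbs measure `cornerGibbsMeasure t V Λ ξ` is the i.i.d.-Bernoulli(`ρ(t)`) mixture,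
`ρ(t) = maskDensity t = (1 - t)/(1 + t)`, over masks `D ⊆ V` of the `t = 0` measures `cornerGibbsMeasure 0 D Λ ξ`
(uniform fillings conditioned to have no odd face in `D`).

Proof.
* Pointwise: `t ^ [f odd] = (1 - t)·[f even] + t`, so by `Finset.prod_add`
  `cornerWeight t V σ = ∑_{D ⊆ V} (1 - t)^|D| · cornerWeight 0 D σ · t^{|V| - |D|}` (`cornerWeight_expand`).
* RANK LEMMA (`cornerPartitionFunction_zero_eq_two_pow`): for `D ⊆ innerVertices Λ` the number of fillings of `Λ`
  with no odd face in `D` is `2 ^ (|Λ| - |D|)`.  Induction on `|D|`, removing the face `g` of `D` maximising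
  `v 0 + v 1`: its NE cell `g + 1` lies in `Λ` and in no other face of `D`, so flipping that cell
  (`s ↦ s ∆ {g + 1}`) is an involution of the fillings preserving the parity of every other face of `D` and
  flipping the parity of `g`; it bijects the fillings even on `D` with those even on `D.erase g` and odd at `g`.
* Hence `Z_t = 2^{|Λ| - |V|} (1 + t)^{|V|}` (binomial theorem, `cornerPartitionFunction_eq_of_le_one`), and the
  coefficients of each Dirac mass `Measure.dirac (boxFill Λ ξ s)` on the two sides agree (`coeff_identity`).
-/

noncomputable section

namespace Summit.CriticalPhenomena.CardyFormulaZ2.Cruxes.IKMixedBoxCrossing.DefectClosureExploration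

open scoped BigOperators ENNReal NNReal symmDiff
open MeasureTheory
open Literature.Probability.LatticeModels

/-! ## Flipping one cell of a filling -/

/-- Flipping the cell `c` of the black set does not change the filling at any other cell. -/
theorem boxFill_symmDiff_apply_of_ne {Λ : Finset (Site 2)} (ξ : Site 2 → Bool) (s : Finset (Site 2))
    {c x : Site 2} (hx : x ≠ c) : boxFill Λ ξ (s ∆ {c}) x = boxFill Λ ξ s x := by
  by_cases hxΛ : x ∈ Λ
  · rw [boxFill_apply_of_mem ξ _ hxΛ, boxFill_apply_of_mem ξ _ hxΛ]
    simp [Finset.mem_symmDiff, hx]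
  · rw [boxFill_apply_of_not_mem ξ _ hxΛ, boxFill_apply_of_not_mem ξ _ hxΛ]

/-- Flipping the cell `c ∈ Λ` of the black set flips the filling at `c`. -/
theorem boxFill_symmDiff_apply_self {Λ : Finset (Site 2)} (ξ : Site 2 → Bool) (s : Finset (Site 2))
    {c : Site 2} (hc : c ∈ Λ) : boxFill Λ ξ (s ∆ {c}) c = !boxFill Λ ξ s c := by
  rw [boxFill_apply_of_mem ξ _ hc, boxFill_apply_of_mem ξ _ hc]
  by_cases h : c ∈ s <;> simp [Finset.mem_symmDiff, h]

/-- Two colourings that agree on the four cells of a face have the same parity there. -/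
theorem isOddFace_congr {σ σ' : Site 2 → Bool} {w : Site 2} (h : ∀ x ∈ cellFace w, σ' x = σ x) :
    IsOddFace σ' w ↔ IsOddFace σ w := by
  unfold IsOddFace blackCount
  rw [Finset.filter_congr (fun x hx => by rw [h x hx])]

/-- Flipping a cell outside the face `w` does not change the parity of `w`. -/
theorem isOddFace_boxFill_symmDiff_of_not_mem {Λ : Finset (Site 2)} (ξ : Site 2 → Bool)
    (s : Finset (Site 2)) {c w : Site 2} (hw : c ∉ cellFace w) :
    IsOddFace (boxFill Λ ξ (s ∆ {c})) w ↔ IsOddFace (boxFill Λ ξ s) w :=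
  isOddFace_congr fun _ hx => boxFill_symmDiff_apply_of_ne ξ s (fun h => hw (h ▸ hx))

/-- The NE cell `w + 1` of the face `w` is none of its three other cells. -/
theorem ne_add_one_cells (w : Site 2) :
    w ≠ w + 1 ∧ w + Pi.single 0 1 ≠ w + 1 ∧ w + Pi.single 1 1 ≠ w + 1 := by
  refine ⟨fun h => ?_, fun h => ?_, fun h => ?_⟩
  · have := congrFun h 0; simp at this
  · have := congrFun h 1; simp at this
  · have := congrFun h 0; simp at this

/-- Flipping the NE cell `w + 1 ∈ Λ` of the face `w` flips the parity of `w`. -/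
theorem isOddFace_boxFill_symmDiff_add_one {Λ : Finset (Site 2)} (ξ : Site 2 → Bool) (s : Finset (Site 2))
    {w : Site 2} (hw : w + 1 ∈ Λ) :
    IsOddFace (boxFill Λ ξ (s ∆ {w + 1})) w ↔ ¬ IsOddFace (boxFill Λ ξ s) w := by
  obtain ⟨h0, h1, h2⟩ := ne_add_one_cells w
  rw [isOddFace_iff_xor, isOddFace_iff_xor, boxFill_symmDiff_apply_of_ne ξ s h0,
    boxFill_symmDiff_apply_of_ne ξ s h1, boxFill_symmDiff_apply_of_ne ξ s h2,
    boxFill_symmDiff_apply_self ξ s hw]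
  cases boxFill Λ ξ s w <;> cases boxFill Λ ξ s (w + Pi.single 0 1) <;>
    cases boxFill Λ ξ s (w + Pi.single 1 1) <;> cases boxFill Λ ξ s (w + 1) <;> decide

/-- If `g` maximises `v 0 + v 1` among `f` and `g ≠ f`, the NE cell `g + 1` of `g` is not a cell of the face `f`
(the three faces other than `g` containing `g + 1` are `g + e₀`, `g + e₁`, `g + 1`, all with a larger `v 0 + v 1`). -/
theorem add_one_not_mem_cellFace {f g : Site 2} (hle : f 0 + f 1 ≤ g 0 + g 1) (hne : f ≠ g) :
    g + 1 ∉ cellFace f := by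
  intro h
  rcases mem_cellFace_iff.1 h with h | h | h | h
  · have h0 := congrFun h 0; have h1 := congrFun h 1
    simp at h0 h1; omega
  · have h0 := congrFun h 0; have h1 := congrFun h 1
    simp at h0 h1; omega
  · have h0 := congrFun h 0; have h1 := congrFun h 1
    simp at h0 h1; omega
  · exact hne (add_right_cancel h).symm

/-- Flipping a cell of `Λ` keeps black sets inside `Λ`. -/
theorem symmDiff_singleton_subset_iff {s Λ : Finset (Site 2)} {c : Site 2} (hc : c ∈ Λ) :
    s ∆ {c} ⊆ Λ ↔ s ⊆ Λ := by
  have key : ∀ u : Finset (Site 2), u ⊆ Λ → u ∆ {c} ⊆ Λ := fun u hu =>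
    Finset.symmDiff_subset_union.trans (Finset.union_subset hu (Finset.singleton_subset_iff.2 hc))
  refine ⟨fun h => ?_, key s⟩
  have := key _ h
  rwa [symmDiff_symmDiff_cancel_right] at this

/-! ## The rank lemma -/

/-- Removing from `D ⊆ innerVertices Λ` its face `g` maximising `v 0 + v 1` doubles the number of fillings with no
odd face in the set: `s ↦ s ∆ {g + 1}` bijects {even on `D.erase g`, odd at `g`} with {even on `D`}. -/
theorem card_filter_even_erase {D Λ : Finset (Site 2)} (hD : D ⊆ innerVertices Λ) (ξ : Site 2 → Bool)
    {g : Site 2} (hg : g ∈ D) (hmax : ∀ f ∈ D, f 0 + f 1 ≤ g 0 + g 1) :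
    (Λ.powerset.filter fun s => ∀ f ∈ D.erase g, ¬ IsOddFace (boxFill Λ ξ s) f).card =
      2 * (Λ.powerset.filter fun s => ∀ f ∈ D, ¬ IsOddFace (boxFill Λ ξ s) f).card := by
  set E := Λ.powerset.filter fun s => ∀ f ∈ D.erase g, ¬ IsOddFace (boxFill Λ ξ s) f with hE
  have hgΛ : g + 1 ∈ Λ :=
    (mem_innerVertices_iff.1 (hD hg)) (mem_cellFace_iff.2 (Or.inr (Or.inr (Or.inr rfl))))
  have h1 : E.filter (fun s => ¬ IsOddFace (boxFill Λ ξ s) g) =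
      Λ.powerset.filter fun s => ∀ f ∈ D, ¬ IsOddFace (boxFill Λ ξ s) f := by
    rw [hE, Finset.filter_filter]
    refine Finset.filter_congr fun s _ => ⟨fun h f hf => ?_,
      fun h => ⟨fun f hf => h f (Finset.mem_of_mem_erase hf), h g hg⟩⟩
    by_cases hfg : f = g
    · rw [hfg]; exact h.2
    · exact h.1 f (Finset.mem_erase.2 ⟨hfg, hf⟩)
  have h2 : (E.filter fun s => IsOddFace (boxFill Λ ξ s) g).card =
      (E.filter fun s => ¬ IsOddFace (boxFill Λ ξ s) g).card := by
    refine Finset.card_equiv (Function.Involutive.toPerm _ (symmDiff_left_involutive {g + 1})) ?_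
    intro s
    have hpar : ∀ f ∈ D.erase g,
        (IsOddFace (boxFill Λ ξ (s ∆ {g + 1})) f ↔ IsOddFace (boxFill Λ ξ s) f) := fun f hf =>
      isOddFace_boxFill_symmDiff_of_not_mem ξ s
        (add_one_not_mem_cellFace (hmax f (Finset.mem_of_mem_erase hf)) (Finset.ne_of_mem_erase hf))
    simp only [hE, Finset.mem_filter, Finset.mem_powerset, Function.Involutive.coe_toPerm,
      symmDiff_singleton_subset_iff hgΛ, isOddFace_boxFill_symmDiff_add_one ξ s hgΛ, not_not]
    exact ⟨fun ⟨⟨hs, hD'⟩, hg'⟩ => ⟨⟨hs, fun f hf hodd => hD' f hf ((hpar f hf).1 hodd)⟩, hg'⟩,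
      fun ⟨⟨hs, hD'⟩, hg'⟩ => ⟨⟨hs, fun f hf hodd => hD' f hf ((hpar f hf).2 hodd)⟩, hg'⟩⟩
  have key := Finset.card_filter_add_card_filter_not (s := E) (fun s => IsOddFace (boxFill Λ ξ s) g)
  rw [h2, h1] at key
  omega

/-- RANK LEMMA, counting form: for `D ⊆ innerVertices Λ` with `|D| = n`,
`2 ^ n · #{s ⊆ Λ | boxFill Λ ξ s has no odd face in D} = 2 ^ |Λ|`. -/
theorem two_pow_mul_card_filter_even {Λ : Finset (Site 2)} (ξ : Site 2 → Bool) :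
    ∀ (n : ℕ) {D : Finset (Site 2)}, D.card = n → D ⊆ innerVertices Λ →
      2 ^ n * (Λ.powerset.filter fun s => ∀ f ∈ D, ¬ IsOddFace (boxFill Λ ξ s) f).card = 2 ^ Λ.card
  | 0, D, hD0, _ => by
      rw [Finset.card_eq_zero] at hD0
      subst hD0
      simp
  | n + 1, D, hDc, hD => by
      have hne : D.Nonempty := Finset.card_pos.1 (by omega)
      obtain ⟨g, hg, hmax⟩ := Finset.exists_max_image D (fun v => v 0 + v 1) hne
      have hcard : (D.erase g).card = n := by rw [Finset.card_erase_of_mem hg, hDc]; rfl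
      have IH := two_pow_mul_card_filter_even ξ n hcard ((Finset.erase_subset g D).trans hD)
      rw [card_filter_even_erase hD ξ hg hmax] at IH
      rw [← IH]
      ring

/-- At `t = 0` the weight is the indicator of "no odd face in `D`". -/
theorem cornerWeight_zero_eq_ite (D : Finset (Site 2)) (σ : Site 2 → Bool) :
    cornerWeight 0 D σ = if ∀ f ∈ D, ¬ IsOddFace σ f then 1 else 0 := by
  split_ifs with h
  · exact cornerWeight_zero_of_forall_not_isOddFace h
  · push Not at h
    obtain ⟨f, hf, hodd⟩ := h
    exact cornerWeight_zero_of_isOddFace hf hodd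

/-- The `t = 0` partition function counts the fillings with no odd face in `D`. -/
theorem cornerPartitionFunction_zero_eq_card (D Λ : Finset (Site 2)) (ξ : Site 2 → Bool) :
    cornerPartitionFunction 0 D Λ ξ =
      ((Λ.powerset.filter fun s => ∀ f ∈ D, ¬ IsOddFace (boxFill Λ ξ s) f).card : ℝ≥0∞) := by
  rw [cornerPartitionFunction]
  simp_rw [cornerWeight_zero_eq_ite]
  rw [Finset.sum_boole]

/-- Inner vertices of `Λ` are cells of `Λ`. -/
theorem innerVertices_subset (Λ : Finset (Site 2)) : innerVertices Λ ⊆ Λ :=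
  fun v hv => (mem_innerVertices_iff.1 hv) (self_mem_cellFace v)

/-- **RANK LEMMA.** For `D ⊆ innerVertices Λ` and any boundary condition, exactly `2 ^ (|Λ| - |D|)` of the
`2 ^ |Λ|` fillings of `Λ` have no odd face in `D`, i.e. `cornerPartitionFunction 0 D Λ ξ = 2 ^ (|Λ| - |D|)`:
the face-parity functionals of inner faces are `𝔽₂`-linearly independent (the face of a dependency maximising
`v 0 + v 1` owns its NE cell alone). -/
theorem cornerPartitionFunction_zero_eq_two_pow {D Λ : Finset (Site 2)} (hD : D ⊆ innerVertices Λ)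
    (ξ : Site 2 → Bool) : cornerPartitionFunction 0 D Λ ξ = 2 ^ (Λ.card - D.card) := by
  have h := two_pow_mul_card_filter_even ξ D.card rfl hD
  have hle : D.card ≤ Λ.card := Finset.card_le_card (hD.trans (innerVertices_subset Λ))
  have hN : (Λ.powerset.filter fun s => ∀ f ∈ D, ¬ IsOddFace (boxFill Λ ξ s) f).card =
      2 ^ (Λ.card - D.card) := by
    refine Nat.eq_of_mul_eq_mul_left (pow_pos two_pos D.card) ?_
    rw [h, ← pow_add, Nat.add_sub_cancel' hle]
  rw [cornerPartitionFunction_zero_eq_card, hN]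
  push_cast
  rfl

/-! ## The mask expansion of the weight and the partition function -/

/-- The weight as a product of single-face factors `t ^ [f odd]`. -/
theorem cornerWeight_eq_prod (t : ℝ≥0) (V : Finset (Site 2)) (σ : Site 2 → Bool) :
    cornerWeight t V σ = ∏ f ∈ V, if IsOddFace σ f then (t : ℝ≥0∞) else 1 := by
  rw [cornerWeight, oddFaceCount, ← Finset.prod_filter, Finset.prod_const]

/-- MASK EXPANSION of the weight (`t ≤ 1`): `t ^ #odd(V) = ∑_{D ⊆ V} (1 - t)^|D| · 1[no odd face in D] ·
t^{|V| - |D|}`, from `t ^ [odd] = (1 - t)·[even] + t` and `Finset.prod_add`. -/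
theorem cornerWeight_expand {t : ℝ≥0} (ht : t ≤ 1) (V : Finset (Site 2)) (σ : Site 2 → Bool) :
    cornerWeight t V σ = ∑ D ∈ V.powerset,
      ((1 - t : ℝ≥0) : ℝ≥0∞) ^ D.card * cornerWeight 0 D σ * (t : ℝ≥0∞) ^ (V.card - D.card) := by
  rw [cornerWeight_eq_prod]
  have h : ∀ f ∈ V, (if IsOddFace σ f then (t : ℝ≥0∞) else 1) =
      (if IsOddFace σ f then 0 else ((1 - t : ℝ≥0) : ℝ≥0∞)) + t := by
    intro f _
    split_ifs
    · rw [zero_add]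
    · rw [← ENNReal.coe_add, tsub_add_cancel_of_le ht, ENNReal.coe_one]
  rw [Finset.prod_congr rfl h, Finset.prod_add]
  refine Finset.sum_congr rfl fun D hD => ?_
  rw [Finset.prod_const, Finset.card_sdiff_of_subset (Finset.mem_powerset.1 hD), cornerWeight_zero_eq_ite]
  congr 1
  split_ifs with hev
  · rw [mul_one, Finset.prod_congr rfl fun f hf => if_neg (hev f hf), Finset.prod_const]
  · rw [mul_zero]
    push Not at hev
    obtain ⟨f, hf, hodd⟩ := hev
    exact Finset.prod_eq_zero hf (if_pos hodd)

/-- PARTITION FUNCTION for `t ≤ 1` and `V ⊆ innerVertices Λ`: `Z_t = 2^{|Λ| - |V|} (1 + t)^{|V|}` (mask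
expansion, rank lemma, binomial theorem). -/
theorem cornerPartitionFunction_eq_of_le_one {t : ℝ≥0} (ht : t ≤ 1) {V Λ : Finset (Site 2)}
    (hV : V ⊆ innerVertices Λ) (ξ : Site 2 → Bool) :
    cornerPartitionFunction t V Λ ξ = 2 ^ (Λ.card - V.card) * ((1 + t : ℝ≥0) : ℝ≥0∞) ^ V.card := by
  have hVΛ : V.card ≤ Λ.card := Finset.card_le_card (hV.trans (innerVertices_subset Λ))
  unfold cornerPartitionFunction
  simp_rw [cornerWeight_expand ht V]
  rw [Finset.sum_comm]
  have h : ∀ D ∈ V.powerset,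
      ∑ s ∈ Λ.powerset, ((1 - t : ℝ≥0) : ℝ≥0∞) ^ D.card * cornerWeight 0 D (boxFill Λ ξ s) *
          (t : ℝ≥0∞) ^ (V.card - D.card) =
        2 ^ (Λ.card - V.card) *
          (((1 - t : ℝ≥0) : ℝ≥0∞) ^ D.card * ((t : ℝ≥0∞) * 2) ^ (V.card - D.card)) := by
    intro D hD
    have hDV : D ⊆ V := Finset.mem_powerset.1 hD
    have hDc : D.card ≤ V.card := Finset.card_le_card hDV
    rw [← Finset.sum_mul, ← Finset.mul_sum]
    have hZ : ∑ s ∈ Λ.powerset, cornerWeight 0 D (boxFill Λ ξ s) = 2 ^ (Λ.card - D.card) :=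
      cornerPartitionFunction_zero_eq_two_pow (hDV.trans hV) ξ
    rw [hZ, show Λ.card - D.card = (Λ.card - V.card) + (V.card - D.card) by omega, pow_add, mul_pow]
    ring
  rw [Finset.sum_congr rfl h, ← Finset.mul_sum, Finset.sum_pow_mul_eq_add_pow]
  congr 2
  rw [mul_two, ← add_assoc, ← ENNReal.coe_add, tsub_add_cancel_of_le ht, ← ENNReal.coe_add]

/-! ## The coefficient identity and the assembly -/

/-- `0 ≤ ρ(t)` for `t ≤ 1`. -/
theorem maskDensity_nonneg {t : ℝ≥0} (ht : t ≤ 1) : 0 ≤ maskDensity t := by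
  unfold maskDensity
  have : (t : ℝ) ≤ 1 := by exact_mod_cast ht
  exact div_nonneg (by linarith) (by positivity)

/-- `ρ(t) ≤ 1` for every `t ≥ 0`. -/
theorem maskDensity_le_one (t : ℝ≥0) : maskDensity t ≤ 1 := by
  unfold maskDensity
  rw [div_le_one (by positivity)]
  have : (0 : ℝ) ≤ t := t.coe_nonneg
  linarith

/-- COEFFICIENT IDENTITY: with `d = |D| ≤ v = |V| ≤ l = |Λ|`,
`(2^{l-v} (1+t)^v)⁻¹ (1-t)^d t^{v-d} = ρ^d (1-ρ)^{v-d} · (2^{l-d})⁻¹`, `ρ = (1-t)/(1+t)`. -/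
theorem coeff_identity {t : ℝ≥0} (ht : t ≤ 1) {d v l : ℕ} (hdv : d ≤ v) (hvl : v ≤ l) :
    (2 ^ (l - v) * ((1 + t : ℝ≥0) : ℝ≥0∞) ^ v)⁻¹ * (((1 - t : ℝ≥0) : ℝ≥0∞) ^ d * (t : ℝ≥0∞) ^ (v - d)) =
      ENNReal.ofReal (maskDensity t ^ d * (1 - maskDensity t) ^ (v - d)) * ((2 : ℝ≥0∞) ^ (l - d))⁻¹ := by
  obtain ⟨m, rfl⟩ := Nat.exists_eq_add_of_le hdv
  obtain ⟨n, rfl⟩ := Nat.exists_eq_add_of_le hvl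
  have e1 : d + m - d = m := by omega
  have e2 : d + m + n - (d + m) = n := by omega
  have e3 : d + m + n - d = m + n := by omega
  rw [e1, e2, e3]
  have h2 : (2 : ℝ≥0∞) ≠ 0 := two_ne_zero
  have h1t : ((1 + t : ℝ≥0) : ℝ≥0∞) ≠ 0 := by simp
  have hL : (2 ^ n * ((1 + t : ℝ≥0) : ℝ≥0∞) ^ (d + m))⁻¹ *
      (((1 - t : ℝ≥0) : ℝ≥0∞) ^ d * (t : ℝ≥0∞) ^ m) ≠ ∞ :=
    ENNReal.mul_ne_top (ENNReal.inv_ne_top.2 (mul_ne_zero (pow_ne_zero _ h2) (pow_ne_zero _ h1t)))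
      (ENNReal.mul_ne_top (ENNReal.pow_ne_top ENNReal.coe_ne_top) (ENNReal.pow_ne_top ENNReal.coe_ne_top))
  have hR : ENNReal.ofReal (maskDensity t ^ d * (1 - maskDensity t) ^ m) * ((2 : ℝ≥0∞) ^ (m + n))⁻¹ ≠ ∞ :=
    ENNReal.mul_ne_top ENNReal.ofReal_ne_top (ENNReal.inv_ne_top.2 (pow_ne_zero _ h2))
  rw [← ENNReal.toReal_eq_toReal_iff' hL hR]
  have hρ := maskDensity_nonneg ht
  have hρ' : 0 ≤ 1 - maskDensity t := sub_nonneg.2 (maskDensity_le_one t)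
  simp only [ENNReal.toReal_mul, ENNReal.toReal_inv, ENNReal.toReal_pow, ENNReal.coe_toReal,
    ENNReal.toReal_ofReal (mul_nonneg (pow_nonneg hρ _) (pow_nonneg hρ' _)), ENNReal.toReal_ofNat,
    NNReal.coe_sub ht, NNReal.coe_add, NNReal.coe_one]
  unfold maskDensity
  have hP : (1 + (t : ℝ)) ≠ 0 := by positivity
  have hρ1 : 1 - (1 - (t : ℝ)) / (1 + t) = (2 * t) / (1 + t) := by field_simp; ring
  rw [hρ1, div_pow, div_pow, mul_pow, pow_add, pow_add]
  have hB : (1 + (t : ℝ)) ^ d ≠ 0 := pow_ne_zero _ hP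
  have hC : (1 + (t : ℝ)) ^ m ≠ 0 := pow_ne_zero _ hP
  have hM : (2 : ℝ) ^ m ≠ 0 := pow_ne_zero _ two_ne_zero
  have hN : (2 : ℝ) ^ n ≠ 0 := pow_ne_zero _ two_ne_zero
  field_simp

/-- **STUB `stub_gadget`** (registered stub of the line `defect-closure-exploration`): the gadget / mask
representation of the corner Gibbs measure, `μ_t^V = ∑_{D ⊆ V} ρ^|D| (1-ρ)^{|V|-|D|} μ_0^D` for `t ≤ 1`,
`V ⊆ innerVertices Λ`, every boundary condition. -/
theorem stub_gadget : GadgetRepresentation := by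
  intro t ht V Λ hV ξ
  simp only [cornerGibbsMeasure, Finset.smul_sum, smul_smul]
  rw [Finset.sum_comm]
  refine Finset.sum_congr rfl fun s _ => ?_
  rw [← Finset.sum_smul]
  congr 1
  rw [cornerWeight_expand ht V, Finset.mul_sum]
  refine Finset.sum_congr rfl fun D hD => ?_
  have hDV : D ⊆ V := Finset.mem_powerset.1 hD
  rw [cornerPartitionFunction_eq_of_le_one ht hV ξ, cornerPartitionFunction_zero_eq_two_pow (hDV.trans hV) ξ]
  have key := coeff_identity ht (Finset.card_le_card hDV)
    (Finset.card_le_card (hV.trans (innerVertices_subset Λ)))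
  calc (2 ^ (Λ.card - V.card) * ((1 + t : ℝ≥0) : ℝ≥0∞) ^ V.card)⁻¹ *
        (((1 - t : ℝ≥0) : ℝ≥0∞) ^ D.card * cornerWeight 0 D (boxFill Λ ξ s) *
          (t : ℝ≥0∞) ^ (V.card - D.card))
      = (2 ^ (Λ.card - V.card) * ((1 + t : ℝ≥0) : ℝ≥0∞) ^ V.card)⁻¹ *
          (((1 - t : ℝ≥0) : ℝ≥0∞) ^ D.card * (t : ℝ≥0∞) ^ (V.card - D.card)) *
            cornerWeight 0 D (boxFill Λ ξ s) := by ring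
    _ = ENNReal.ofReal (maskDensity t ^ D.card * (1 - maskDensity t) ^ (V.card - D.card)) *
          ((2 : ℝ≥0∞) ^ (Λ.card - D.card))⁻¹ * cornerWeight 0 D (boxFill Λ ξ s) := by rw [key]
    _ = _ := by ring

end Summit.CriticalPhenomena.CardyFormulaZ2.Cruxes.IKMixedBoxCrossing.DefectClosureExploration

end
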